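import Mathlib
import HarnessLib
import Summits.HubbardSuperconductivity.HubbardSuperconductivity.Theorems.KLProgrammeKLRegimeEnginePairTransferOutClassForwardQuarter
import Summits.HubbardSuperconductivity.HubbardSuperconductivity.Theorems.KLProgrammeKLRegimeEnginePairTransferOutClassForwardCrossedQuarter
import Summits.HubbardSuperconductivity.HubbardSuperconductivity.Theorems.KLProgrammeKLRegimeEnginePairTransferOutClassSameFrame
import Summits.HubbardSuperconductivity.HubbardSuperconductivity.Theorems.KLProgrammeKLRegimeEnginePairTransferOutClassForwardCrossedQuarterSplit3

/-!
# Route `KLProgramme` — ENGINE item stmt-HubbardSuperconductivity-20437 `KLRegimeEngineV17F2`, stub (c) value lane «(c)-OUT» CAPSTONE × located-risk #9 «ZS-L1»: THE SAME-FRAME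
# OUT-OF-CLASS INCREMENT IN THE SLOTS OF (E2″-F)ₙ₊₁ UNDER THE THREE-WAY KERNEL SPLIT `V_j⊗V_j = c₀ + F₁ + F₂` (cell gate-hubbard-kl, seat hubbard-kl-k3c2-p2 g21)

WHY.  `outClass_sameFrame_le_slots` (…OutClassSameFrame, g18) keys the forward-window member lines on the kernel data `(A₀, L_A, ε)` of the FULL kernel `V_j⊗V_j`
at every `t ∈ [0,1]` — sup-currency data that are not dischargeable at deep scales (the dressed kernel varies on scale `Λ`), with a flat-cubic `ε` entry (located
«(A25)-FLAT-HOST-VS-CHILD1», pen (R278)(B) located-risk #9).  This twin re-keys BOTH member lines on class #1's split «(E4)-DRESSED-SPLIT»: at every `t`,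
`V_t⊗V_t = c₀ + F₁(t) + F₂(t)` (direct leg pattern) and `= c₀ + Fx₁(t) + Fx₂(t)` (crossed leg pattern) with ONE constant `c₀` (a `k`-constant difference between the two
local parts, or its `t`-variation, is an admissible part of `F₁`), `F₁/Fx₁` with pins and data `(A₁, L₁, ε₁)`, `F₂/Fx₂` of sup `A₂` supported in the loop-momentum windows
`|k − cen|_𝕋 ≤ ρw` / `|k − cenx|_𝕋 ≤ ρw`.  The slots are g18's with `(A₀, L_A, ε) := (2‖c₀‖ + A₁, L₁, ε₁)` and the flatness entry `ε·2048·15367` replaced by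
`ε₁·2048·15367 + A₂·4096·15381·(ρw/π + 1/L)` (the window part is a DECAYING cubic when `ρw = c_w·Λₙ₊₁`):
**`outClass_sameFrame_le_slots_split3`** — proof = g18's case split verbatim (shallow / plateau / tail cases are sign-blind and untouched), the two forward-window cases by
`forward_member_direct/crossed_row_le_quarter_split3` (…ForwardQuarterSplit3 / …ForwardCrossedQuarterSplit3).
Binders otherwise as g18 (rows-family objects literal, `M4`, frame window, sizes `ZS₀ ≤ 2⁵²K`, `TH₀ ≤ 2⁷⁶K`, `TH₀ + 2TR₀ ≤ 2⁷⁶K`, `TR₀G ≤ 2⁵²K` at `A₀ = 2‖c₀‖ + A₁`).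
Composition only; the split and its data are binders (class #1's export); nothing asserts (E2″-F), (c), K3 or superconductivity.  0 kit · 0 lit.
-/


noncomputable section

namespace Summit.HubbardSuperconductivity.HubbardSuperconductivity.Theorems.KLRegimeSplit

set_option linter.dupNamespace false -- summit = problem name (single-conjunct summit), D-0017

open Real Set Finset Complex Matrix Literature.MathematicalPhysics.QuantumLattice GrassmannAlgebra
open Literature.Probability.LatticeModels hiding torusSupNorm
open Literature.MathematicalPhysics.QuantumLattice.BandSectorCounting
open Summit.HubbardSuperconductivity.HubbardSuperconductivity.Theorems.KLProgrammeLegKernels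
open Summit.HubbardSuperconductivity.HubbardSuperconductivity.Theorems.KLRegimeWick
open Summit.HubbardSuperconductivity.HubbardSuperconductivity.Theorems.TwoPointAssembly
open Summit.HubbardSuperconductivity.HubbardSuperconductivity.Theorems.EngineV8
open Summit.HubbardSuperconductivity.HubbardSuperconductivity.Theorems.DispersionFlow
open Summit.HubbardSuperconductivity.HubbardSuperconductivity.Theorems.PerturbedFermiCurve

section Model

variable (L M : ℕ) [NeZero L] [NeZero M] (β U μ : ℝ) (K : TrigPolyC4v) {a' b' : ℝ} (B : BandBounds a' b') {R : RenConsts} {N : ℕ} {Af : ℝ}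

set_option maxHeartbeats 1600000 in -- one theorem over ~60 literal binders; two `klmd_sum*_ite_mul_le` instantiations and six case bookings; plumbing only
/-- **THE SAME-FRAME OUT-OF-CLASS INCREMENT IN THE SLOTS OF (E2″-F)ₙ₊₁, THREE-WAY KERNEL SPLIT** (module docstring). -/
theorem outClass_sameFrame_le_slots_split3 (hR : R.WF2) (hU : 0 < U) (hUu : U ≤ klTSU R) (hμC : μ ∈ klWindowC) (hK : FrameOK R U N μ K)
    (hβ : klBetaMin ≤ β) (hβL : β ≤ L) {n : ℕ} (hn : n ≤ nScales β) (hGL : 8 * (4 + 8 / 3 * R.Gfr 1 * U ^ 2) * β ≤ L) (hGU : 8 / 3 * R.Gfr 1 * U ^ 2 ≤ 1)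
    (hAb : ∀ p : Momentum, ∀ j ≤ 2, ‖iteratedFDeriv ℝ j (frameShift K) p‖ ≤ Af) (hA : 4 * Af < B.Dtmin) (hA20 : 4 * Af ≤ 1 / 20) (hμ : μ ≤ -0.15)
    (hlo : a' < μ - 4 * klScale klE0 (n + 1) - 4 * Af) (hhi : μ + 4 * klScale klE0 (n + 1) + 4 * Af < b')
    (hM : β * (4 * klScale klE0 (n + 1)) / (2 * Real.pi) + 1 ≤ M)
    (A A' : ℕ → TorusSite 2 L → ℝ → Matrix (TorusSite 2 L) (TorusSite 2 L) ℂ) (b' : ℕ → TorusSite 2 L → ℝ → TorusSite 2 L → ℂ)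
    (hAdef : A = fun j Qm t => Matrix.of fun k k' : TorusSite 2 L => if k ∈ klBall L μ 0 ∧ k' ∈ klBall L μ 0 then
      vertexFn L M β (gaussConv ℂ (softCovOf L M β μ K (softSymbolCompl L M β μ K (n + 1) j) + hubbardCovAboveCT L M β μ 0 K (klScale klE0 (n + 1)) - hubbardCovAboveCT L M β μ 0 K
              (klScale klE0 n + t * (klScale klE0 (n + 1) - klScale klE0 n))) (hubbardEffectiveActionCT L M β U μ 0 K (klScale klE0 n + t * (klScale klE0 (n + 1) - klScale klE0 n)))) 4
              ![(((omega0 M, k'), 0), 0), ((((omega0 M).rev, Qm - k'), 1), 0), ((((omega0 M).rev, Qm - k), 1), 1), (((omega0 M, k), 0), 1)]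
      else 0)
    (hA'def : A' = fun j Qm t => Matrix.of fun k k' : TorusSite 2 L => if k ∈ klBall L μ 0 ∧ k' ∈ klBall L μ 0 then
      (klScale klE0 (n + 1) - klScale klE0 n) • -((2 : ℂ)⁻¹ * vertexFn L M β (gaussConv ℂ (softCovOf L M β μ K (softSymbolCompl L M β μ K (n + 1) j) + hubbardCovAboveCT L M β μ 0 K
              (klScale klE0 (n + 1)) - hubbardCovAboveCT L M β μ 0 K (klScale klE0 n + t * (klScale klE0 (n + 1) - klScale klE0 n))) (grassmannDerivPairing ℂ (Matrix.of fun X Y :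
              HubbardFieldIdx L M => deriv (fun Λ'' : ℝ => hubbardCovAboveCT L M β μ 0 K Λ'' X Y) (klScale klE0 n + t * (klScale klE0 (n + 1) - klScale klE0 n)))
              (hubbardEffectiveActionCT L M β U μ 0 K (klScale klE0 n + t * (klScale klE0 (n + 1) - klScale klE0 n))) (hubbardEffectiveActionCT L M β U μ 0 K (klScale klE0 n + t *
              (klScale klE0 (n + 1) - klScale klE0 n))))) 4 ![(((omega0 M, k'), 0), 0), ((((omega0 M).rev, Qm - k'), 1), 0), ((((omega0 M).rev, Qm - k), 1), 1), (((omega0 M, k), 0),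
              1)])
      else 0)
    (hb'def : b' = fun (j : ℕ) (Qm : TorusSite 2 L) (t : ℝ) (p : TorusSite 2 L) => (((klScale klE0 (n + 1) - klScale klE0 n) *
        (klBubbleMass L M β μ K (fun k => deriv (fun Λ' => hubbardCutoffWeightCT L M β μ K Λ' k) (klScale klE0 n + t * (klScale klE0 (n + 1) - klScale klE0 n))) (fun k =>
                (softSymbolCompl L M β μ K (n + 1) j) k + (hubbardCutoffWeightCT L M β μ K (klScale klE0 (n + 1)) k - hubbardCutoffWeightCT L M β μ K (klScale klE0 n + t * (klScale
                klE0 (n + 1) - klScale klE0 n)) k)) Qm p +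
          klBubbleMass L M β μ K (fun k => (softSymbolCompl L M β μ K (n + 1) j) k + (hubbardCutoffWeightCT L M β μ K (klScale klE0 (n + 1)) k - hubbardCutoffWeightCT L M β μ K
                  (klScale klE0 n + t * (klScale klE0 (n + 1) - klScale klE0 n)) k)) (fun k => deriv (fun Λ' => hubbardCutoffWeightCT L M β μ K Λ' k) (klScale klE0 n + t * (klScale
                  klE0 (n + 1) - klScale klE0 n))) Qm p) : ℝ) : ℂ))
    (V : ℕ → ℝ → (Fin 4 → HubbardFieldIdx L M) → ℂ) (hV : V = fun j t X => vertexFn L M β (gaussConv ℂ (softCovOf L M β μ K (softSymbolCompl L M β μ K (n + 1) j) + hubbardCovAboveCT L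
            M β μ 0 K (klScale klE0 (n + 1)) - hubbardCovAboveCT L M β μ 0 K (klScale klE0 n + t * (klScale klE0 (n + 1) - klScale klE0 n))) (hubbardEffectiveActionCT L M β U μ 0 K
            (klScale klE0 n + t * (klScale klE0 (n + 1) - klScale klE0 n)))) 4 X)
    (V6 : ℕ → ℝ → (Fin 6 → HubbardFieldIdx L M) → ℂ) (hV6 : V6 = fun j t X => vertexFn L M β (gaussConv ℂ (softCovOf L M β μ K (softSymbolCompl L M β μ K (n + 1) j) + hubbardCovAboveCT
            L M β μ 0 K (klScale klE0 (n + 1)) - hubbardCovAboveCT L M β μ 0 K (klScale klE0 n + t * (klScale klE0 (n + 1) - klScale klE0 n))) (hubbardEffectiveActionCT L M β U μ 0 K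
            (klScale klE0 n + t * (klScale klE0 (n + 1) - klScale klE0 n)))) 6 X)
    (Sg : ℕ → ℝ → FreqMomentum L M → Fin 2 → ℂ) (hSg : Sg = fun j t p σ => selfEnergy L M β (gaussConv ℂ (softCovOf L M β μ K (softSymbolCompl L M β μ K (n + 1) j) + hubbardCovAboveCT
            L M β μ 0 K (klScale klE0 (n + 1)) - hubbardCovAboveCT L M β μ 0 K (klScale klE0 n + t * (klScale klE0 (n + 1) - klScale klE0 n))) (hubbardEffectiveActionCT L M β U μ 0 K
            (klScale klE0 n + t * (klScale klE0 (n + 1) - klScale klE0 n)))) p σ)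
    (Hd : ℕ → ℝ → (Fin 4 → HubbardFieldIdx L M) → ℂ) (hHd : Hd = fun j t X => vertexFn L M β (dblFold ℂ (grassmannLaplacian ℂ (crossCov ℂ (Matrix.of fun X Y : HubbardFieldIdx L M =>
            deriv (fun Λ' : ℝ => hubbardCovAboveCT L M β μ 0 K Λ' X Y) (klScale klE0 n + t * (klScale klE0 (n + 1) - klScale klE0 n)))) ((gaussConv ℂ (crossCov ℂ (softCovOf L M β μ K
            (softSymbolCompl L M β μ K (n + 1) j) + hubbardCovAboveCT L M β μ 0 K (klScale klE0 (n + 1)) - hubbardCovAboveCT L M β μ 0 K (klScale klE0 n + t * (klScale klE0 (n + 1) -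
            klScale klE0 n)))) - grassmannLaplacian ℂ (crossCov ℂ (softCovOf L M β μ K (softSymbolCompl L M β μ K (n + 1) j) + hubbardCovAboveCT L M β μ 0 K (klScale klE0 (n + 1)) -
            hubbardCovAboveCT L M β μ 0 K (klScale klE0 n + t * (klScale klE0 (n + 1) - klScale klE0 n))))) (dblCopy ℂ 0 (gaussConv ℂ (softCovOf L M β μ K (softSymbolCompl L M β μ K (n
            + 1) j) + hubbardCovAboveCT L M β μ 0 K (klScale klE0 (n + 1)) - hubbardCovAboveCT L M β μ 0 K (klScale klE0 n + t * (klScale klE0 (n + 1) - klScale klE0 n)))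
            (hubbardEffectiveActionCT L M β U μ 0 K (klScale klE0 n + t * (klScale klE0 (n + 1) - klScale klE0 n)))) * dblCopy ℂ 1 (gaussConv ℂ (softCovOf L M β μ K (softSymbolCompl L
            M β μ K (n + 1) j) + hubbardCovAboveCT L M β μ 0 K (klScale klE0 (n + 1)) - hubbardCovAboveCT L M β μ 0 K (klScale klE0 n + t * (klScale klE0 (n + 1) - klScale klE0 n)))
            (hubbardEffectiveActionCT L M β U μ 0 K (klScale klE0 n + t * (klScale klE0 (n + 1) - klScale klE0 n)))))))) 4 X)
    (Φ : ℕ → ℝ → FreqMomentum L M → ℝ) (hΦ : Φ = fun j t k => (softSymbolCompl L M β μ K (n + 1) j) k + (hubbardCutoffWeightCT L M β μ K (klScale klE0 (n + 1)) k -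
            hubbardCutoffWeightCT L M β μ K (klScale klE0 n + t * (klScale klE0 (n + 1) - klScale klE0 n)) k))
    (Wd : ℝ → FreqMomentum L M → ℝ) (hWd : Wd = fun t k => deriv (fun Λ' : ℝ => hubbardCutoffWeightCT L M β μ K Λ' k) (klScale klE0 n + t * (klScale klE0 (n + 1) - klScale klE0 n)))
    (Br : ℕ → TorusSite 2 L → ℝ → TorusSite 2 L × MatsubaraIdx M → ℂ) (hBr : Br = fun j Qm t z => -(((((β * (L : ℝ) ^ 2 : ℝ) : ℂ)))⁻¹ * propCT L M β μ K (z.2, z.1) * propCT L M β μ K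
            (z.2.rev, Qm - z.1)) *
      ((((klScale klE0 (n + 1) - klScale klE0 n) * (-Wd t (z.2, z.1) * Φ j t (z.2.rev, Qm - z.1) - Φ j t (z.2, z.1) * Wd t (z.2.rev, Qm - z.1))) : ℝ) : ℂ))
    (j : ℕ) (hj : n + 1 ≤ j) {Qm : TorusSite 2 L} (hQ : ¬ IsPairClassAt L Qm (n + 1))
    (hZ : ∀ Λ ∈ Icc (klScale klE0 (n + 1)) (klScale klE0 n), hubbardEffPartitionFnCT L M β U μ 0 K Λ ≠ 0)
    {P : SplitConsts} {m : ℝ} (hm0 : 0 ≤ m) (hm : m ^ 2 ≤ 2 ^ 8 * (P.Klam * U) ^ 2) (hAm : ∀ t ∈ Icc (0 : ℝ) 1, ∀ x y, ‖A j Qm t x y‖ ≤ m)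
    (x y : TorusSite 2 L) {M4 RH RS RL : ℝ} (hM40 : 0 ≤ M4) (hM4 : ∀ t ∈ Icc (0 : ℝ) 1, ∀ X, ‖V j t X‖ ≤ M4)
    (hM4K : M4 * M4 ≤ 2 ^ 3 * (P.Klam * U) ^ 2) (hM4KG : M4 * M4 * (4 + 8 / 3 * R.Gfr 1 * U ^ 2) ^ 2 ≤ 2 ^ 32 * (P.Klam * U) ^ 2)
    (hH : ∀ t ∈ Icc (0 : ℝ) 1, ‖Hd j t ![(((omega0 M, y), 0), 0), ((((omega0 M).rev, Qm - y), 1), 0), ((((omega0 M).rev, Qm - x), 1), 1), (((omega0 M, x), 0), 1)]‖ ≤ RH)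
    (hRS : ∀ t ∈ Icc (0 : ℝ) 1, ‖(∑ p : FreqMomentum L M, ∑ σ : Fin 2,
            (((((Wd t p) : ℝ) : ℂ) * (((β * (L : ℝ) ^ 2 : ℝ) : ℂ) * propCT L M β μ K p)) * ((((Φ j t p) : ℝ) : ℂ) * (((β * (L : ℝ) ^ 2 : ℝ) : ℂ) * propCT L M β μ K p))) *
              (V6 j t ![((p, σ), 0), ((p, σ), 1), (((omega0 M, y), 0), 0), ((((omega0 M).rev, Qm - y), 1), 0), ((((omega0 M).rev, Qm - x), 1), 1),
                (((omega0 M, x), 0), 1)] *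
                Sg j t p σ))‖ ≤ RS)
    (hL : ∀ t ∈ Icc (0 : ℝ) 1, ‖∑ z : TorusSite 2 L × MatsubaraIdx M, Br j Qm t z *
          ((if z.1 ∈ klBall L μ 0 then
              V j t ![(((omega0 M, z.1), 0), 0), ((((omega0 M).rev, Qm - z.1), 1), 0), ((((omega0 M).rev, Qm - x), 1), 1), (((omega0 M, x), 0), 1)] *
                V j t ![(((omega0 M, y), 0), 0), ((((omega0 M).rev, Qm - y), 1), 0), ((((omega0 M).rev, Qm - z.1), 1), 1), (((omega0 M, z.1), 0), 1)]
            else 0) -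
            V j t ![(((z.2, z.1), 0), 0), (((z.2.rev, Qm - z.1), 1), 0), ((((omega0 M).rev, Qm - x), 1), 1), (((omega0 M, x), 0), 1)] *
              V j t ![(((omega0 M, y), 0), 0), ((((omega0 M).rev, Qm - y), 1), 0), (((z.2.rev, Qm - z.1), 1), 1), (((z.2, z.1), 0), 1)])‖ ≤ RL)
    (c₀ : ℂ) (F₁ F₂ : ℝ → FreqMomentum L M → Fin 2 → FreqMomentum L M → ℂ) (F₁₀ : ℝ → TorusSite 2 L → Fin 2 → TorusSite 2 L → ℂ)
    (hsplit : ∀ t ∈ Icc (0 : ℝ) 1, ∀ (p : FreqMomentum L M) (σ : Fin 2) (p' : FreqMomentum L M),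
      V j t ![((p, σ), 1), ((p', σ), 0), (((omega0 M, y), 0), 0), (((omega0 M, x), 0), 1)] *
          V j t ![((p, σ), 0), ((p', σ), 1), ((((omega0 M).rev, Qm - y), 1), 0), ((((omega0 M).rev, Qm - x), 1), 1)] = c₀ + F₁ t p σ p' + F₂ t p σ p')
    (Fx₁ Fx₂ : ℝ → FreqMomentum L M → FreqMomentum L M → ℂ) (Fx₁₀ : ℝ → TorusSite 2 L → TorusSite 2 L → ℂ)
    (hsplitX : ∀ t ∈ Icc (0 : ℝ) 1, ∀ (p p' : FreqMomentum L M),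
      V j t ![((p, 0), 1), ((p', 1), 0), (((omega0 M, y), 0), 0), ((((omega0 M).rev, Qm - x), 1), 1)] *
          V j t ![((p, 0), 0), ((p', 1), 1), ((((omega0 M).rev, Qm - y), 1), 0), (((omega0 M, x), 0), 1)] = c₀ + Fx₁ t p p' + Fx₂ t p p')
    {A₁ L₁ ε₁ : ℝ} (hA1 : 0 ≤ A₁) (hL1 : 0 ≤ L₁) (hε1 : 0 ≤ ε₁)
    (hY0p₁ : ∀ t ∈ Icc (0 : ℝ) 1, ∀ k : TorusSite 2 L, ‖∑ σ : Fin 2, F₁₀ t k σ (k + (x - y))‖ ≤ A₁)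
    (hY1p₁ : ∀ t ∈ Icc (0 : ℝ) 1, ∀ k k' : TorusSite 2 L,
      ‖(∑ σ : Fin 2, F₁₀ t k σ (k + (x - y))) - ∑ σ : Fin 2, F₁₀ t k' σ (k' + (x - y))‖ ≤ L₁ * klTorusNorm L (k - k'))
    (hY0m₁ : ∀ t ∈ Icc (0 : ℝ) 1, ∀ k : TorusSite 2 L, ‖∑ σ : Fin 2, F₁₀ t (k + -(x - y)) σ k‖ ≤ A₁)
    (hY1m₁ : ∀ t ∈ Icc (0 : ℝ) 1, ∀ k k' : TorusSite 2 L,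
      ‖(∑ σ : Fin 2, F₁₀ t (k + -(x - y)) σ k) - ∑ σ : Fin 2, F₁₀ t (k' + -(x - y)) σ k'‖ ≤ L₁ * klTorusNorm L (k - k'))
    (hflat₁ : ∀ t ∈ Icc (0 : ℝ) 1, ∀ (i : MatsubaraIdx M) (σ : Fin 2) (k k' : TorusSite 2 L), matsubaraFreq β M i ^ 2 ≤ (4 * klScale klE0 (n + 1)) ^ 2 →
      ‖F₁ t (i, k) σ (i, k') - F₁₀ t k σ k'‖ ≤ ε₁)
    (hY0B₁ : ∀ t ∈ Icc (0 : ℝ) 1, ∀ k : TorusSite 2 L, ‖Fx₁₀ t k (k + (Qm - x - y))‖ ≤ A₁)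
    (hY1B₁ : ∀ t ∈ Icc (0 : ℝ) 1, ∀ k k' : TorusSite 2 L, ‖Fx₁₀ t k (k + (Qm - x - y)) - Fx₁₀ t k' (k' + (Qm - x - y))‖ ≤ L₁ * klTorusNorm L (k - k'))
    (hY0A₁ : ∀ t ∈ Icc (0 : ℝ) 1, ∀ k : TorusSite 2 L, ‖Fx₁₀ t (k + -(Qm - x - y)) k‖ ≤ A₁)
    (hY1A₁ : ∀ t ∈ Icc (0 : ℝ) 1, ∀ k k' : TorusSite 2 L, ‖Fx₁₀ t (k + -(Qm - x - y)) k - Fx₁₀ t (k' + -(Qm - x - y)) k'‖ ≤ L₁ * klTorusNorm L (k - k'))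
    (hflatX₁ : ∀ t ∈ Icc (0 : ℝ) 1, ∀ (i i' : MatsubaraIdx M) (k k' : TorusSite 2 L), matsubaraInt M i' + 1 = matsubaraInt M i →
      matsubaraFreq β M i ^ 2 ≤ (5 * klScale klE0 (n + 1)) ^ 2 → ‖Fx₁ t (i, k) (i', k') - Fx₁₀ t k k'‖ ≤ ε₁)
    (cen cenx : TorusSite 2 L) {ρw A₂ : ℝ} (hρw : 0 ≤ ρw) (hA2 : 0 ≤ A₂)
    (hF₂ : ∀ t ∈ Icc (0 : ℝ) 1, ∀ (p : FreqMomentum L M) (σ : Fin 2) (p' : FreqMomentum L M), ‖F₂ t p σ p'‖ ≤ A₂)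
    (hsupp₂ : ∀ t ∈ Icc (0 : ℝ) 1, ∀ (p : FreqMomentum L M) (σ : Fin 2) (p' : FreqMomentum L M), ρw < klTorusNorm L (p.2 - cen) → F₂ t p σ p' = 0)
    (hFx₂ : ∀ t ∈ Icc (0 : ℝ) 1, ∀ (p p' : FreqMomentum L M), ‖Fx₂ t p p'‖ ≤ A₂)
    (hsuppx₂ : ∀ t ∈ Icc (0 : ℝ) 1, ∀ (p p' : FreqMomentum L M), ρw < klTorusNorm L (p.2 - cenx) → Fx₂ t p p' = 0)
    (hZS : (524288 / Real.pi * (64 * (klScale klE0 (n + 1) / klScale klE0 j) ^ 2 + (2 * (448 / 3 * Real.exp 2) + 8) + 64) * (Real.pi * Real.sqrt 2 / (B.Dtmin - 4 * Af) * (2 * L₁ + 2 * (2 * ‖c₀‖ + A₁) * (2 / (1 / 10))) / (B.Dtmin - 4 * Af) + 2 * (2 * ‖c₀‖ + A₁) * (1 / (B.Dtmin - 4 * Af) ^ 2 + Real.pi * Real.sqrt 2 * (2 + 4 * Af) / (B.Dtmin - 4 * Af) ^ 3))) ≤ 2 ^ 52 * (P.Klam * U) ^ 2)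
    (hTH : (393216 / Real.pi * (64 * (klScale klE0 (n + 1) / klScale klE0 j) ^ 2 + (2 * (448 / 3 * Real.exp 2) + 8) + 64) * (2 * (2 * ‖c₀‖ + A₁) * (Real.pi * Real.sqrt 2 / (B.Dtmin - 4 * Af)))) ≤ 2 ^ 76 * (P.Klam * U) ^ 2)
    (hTHR : (393216 / Real.pi * (64 * (klScale klE0 (n + 1) / klScale klE0 j) ^ 2 + (2 * (448 / 3 * Real.exp 2) + 8) + 64) * (2 * (2 * ‖c₀‖ + A₁) * (Real.pi * Real.sqrt 2 / (B.Dtmin - 4 * Af)))) + 2 * (256 / Real.pi * 8 * (2 * (2 * ‖c₀‖ + A₁) * (Real.pi * Real.sqrt 2 / (B.Dtmin - 4 * Af))) * (65 * (8 * (16 : ℝ) ^ (j - (n + 1))) + 17408 / 3 * 1)) ≤ 2 ^ 76 * (P.Klam * U) ^ 2)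
    (hTR : (256 / Real.pi * 8 * (2 * (2 * ‖c₀‖ + A₁) * (Real.pi * Real.sqrt 2 / (B.Dtmin - 4 * Af))) * (65 * (8 * (16 : ℝ) ^ (j - (n + 1))) + 17408 / 3 * 1)) * (4 + 8 / 3 * R.Gfr 1 * U ^ 2) ≤ 2 ^ 52 * (P.Klam * U) ^ 2) :
    ‖A j Qm 1 x y - A j Qm 0 x y‖ ≤
      (klScale klE0 n - klScale klE0 (n + 1)) * (2⁻¹ * RH + ((β * (L : ℝ) ^ 2) ^ 3)⁻¹ * (2 * RS)) + RL +
        gainBar klEngGeo11 P U (n + 1) (klTorusNorm L Qm) (klTorusNorm L (x - y)) (klTorusNorm L (x + y - Qm)) +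
        thermalBar klEngGeo11 P U β (n + 1) / 2 + 4 * ((96 * (512 * L₁ / klScale klE0 (n + 1) + 32 * (2 * ‖c₀‖ + A₁) * (4 + 8 / 3 * R.Gfr 1 * U ^ 2) * ((9 * (2 * (448 / 3 * Real.exp 2) + 8) + 4 * 8) + (65 * (8 * (16 : ℝ) ^ (j - (n + 1))) + 17408 / 3 * 1)) / klScale klE0 (n + 1) ^ 2)) / L) + 2 * ((ε₁ * (2048 * 15367) + A₂ * (4096 * 15381) * (ρw / π + ((L : ℝ))⁻¹))) := by
  have hβ0 : 0 < β := pos_of_klBetaMin_le hβ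
  have hL0 : (0 : ℝ) < L := by exact_mod_cast Nat.pos_of_ne_zero (NeZero.ne L)
  have hGfr' : ∀ j, 0 ≤ R.Gfr j := hR.wf.2.2
  have h83 : 0 ≤ 8 / 3 * R.Gfr 1 * U ^ 2 := by have := hGfr' 1; positivity
  have hG4 : 4 ≤ (4 + 8 / 3 * R.Gfr 1 * U ^ 2) := by linarith only [h83]
  have hG21 : (4 + 8 / 3 * R.Gfr 1 * U ^ 2) ≤ 2 ^ 21 := bandLipschitz_le_two_pow hGU
  have hΛ1 : 0 < klScale klE0 (n + 1) := klth_klScale_pos (n + 1)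
  have hsucc : klScale klE0 (n + 1) = klScale klE0 n / 4 := klth_klScale_succ n
  have ha : 0 < (klScale klE0 n - klScale klE0 (n + 1)) := by rw [hsucc]; linarith
  have hc : 0 < ((β * (L : ℝ) ^ 2) ^ 3)⁻¹ := by positivity
  have hac : 0 < (klScale klE0 n - klScale klE0 (n + 1)) * ((β * (L : ℝ) ^ 2) ^ 3)⁻¹ := mul_pos ha hc
  have hKl : 0 ≤ (P.Klam * U) ^ 2 := sq_nonneg _
  have hMM : 0 ≤ M4 * M4 := mul_nonneg hM40 hM40
  have hn' : n + 1 ≤ nScales β + 1 := by omega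
  have hρd0 : 0 ≤ klTorusNorm L (x - y) := torusSupNorm_nonneg _
  have hρx0 : 0 ≤ klTorusNorm L (x + y - Qm) := torusSupNorm_nonneg _
  have hρxe : klTorusNorm L (Qm - x - y) = klTorusNorm L (x + y - Qm) := by
    rw [show Qm - x - y = -(x + y - Qm) by abel, klTorusNorm_neg]
  have hTB0 : 0 ≤ thermalBar klEngGeo11 P U β (n + 1) := by
    unfold thermalBar; exact mul_nonneg (mul_nonneg klEngGeo11_CF_nonneg hKl) (by positivity)
  have hΛj := klth_klScale_pos j
  have hLt0 : 0 ≤ (96 * (512 * L₁ / klScale klE0 (n + 1) + 32 * (2 * ‖c₀‖ + A₁) * (4 + 8 / 3 * R.Gfr 1 * U ^ 2) * ((9 * (2 * (448 / 3 * Real.exp 2) + 8) + 4 * 8) + (65 * (8 * (16 : ℝ) ^ (j - (n + 1))) + 17408 / 3 * 1)) / klScale klE0 (n + 1) ^ 2)) / L := by positivity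
  have hph0 : ∀ m' ρ, 0 ≤ klEngGeo11.phGain m' ρ := klEngGeo11_wf.2.2.2.2.2.2.2.2.2.2.2.2.1
  have hεF : 0 ≤ (ε₁ * (2048 * 15367) + A₂ * (4096 * 15381) * (ρw / π + ((L : ℝ))⁻¹)) := by positivity
  -- ===== the direct member line `RP` under its envelope `BP`
  have hBP : ∀ t ∈ Icc (0 : ℝ) 1, (klScale klE0 n - klScale klE0 (n + 1)) * ((β * (L : ℝ) ^ 2) ^ 3)⁻¹ *
      ‖∑ p : FreqMomentum L M, ∑ σ : Fin 2, ∑ p' : FreqMomentum L M,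
        if matsubaraInt M p'.1 + matsubaraInt M (omega0 M) = matsubaraInt M p.1 + matsubaraInt M (omega0 M) ∧ p'.2 = p.2 + x - y then
          ((((((Φ j t p) : ℝ) : ℂ) * (((β * (L : ℝ) ^ 2 : ℝ) : ℂ) * propCT L M β μ K p)) * ((((Wd t p') : ℝ) : ℂ) * (((β * (L : ℝ) ^ 2 : ℝ) : ℂ) * propCT L M β μ K p'))) +
              (((((Wd t p) : ℝ) : ℂ) * (((β * (L : ℝ) ^ 2 : ℝ) : ℂ) * propCT L M β μ K p)) * ((((Φ j t p') : ℝ) : ℂ) * (((β * (L : ℝ) ^ 2 : ℝ) : ℂ) * propCT L M β μ K p')))) *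
            (V j t ![((p, σ), 1), ((p', σ), 0), (((omega0 M, y), 0), 0), (((omega0 M, x), 0), 1)] *
              V j t ![((p, σ), 0), ((p', σ), 1), ((((omega0 M).rev, Qm - y), 1), 0), ((((omega0 M).rev, Qm - x), 1), 1)])
        else 0‖ ≤
      ((P.Klam * U) ^ 2 * klEngGeo11.phGain (n + 1) (klTorusNorm L (x - y)) + thermalBar klEngGeo11 P U β (n + 1) / 4 + 2 * ((96 * (512 * L₁ / klScale klE0 (n + 1) + 32 * (2 * ‖c₀‖ + A₁) * (4 + 8 / 3 * R.Gfr 1 * U ^ 2) * ((9 * (2 * (448 / 3 * Real.exp 2) + 8) + 4 * 8) + (65 * (8 * (16 : ℝ) ^ (j - (n + 1))) + 17408 / 3 * 1)) / klScale klE0 (n + 1) ^ 2)) / L) + (ε₁ * (2048 * 15367) + A₂ * (4096 * 15381) * (ρw / π + ((L : ℝ))⁻¹))) := by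
    intro t ht
    have hK4 : ∀ X X', ‖V j t X * V j t X'‖ ≤ M4 * M4 := fun X X' => by
      rw [norm_mul]; exact mul_le_mul (hM4 t ht X) (hM4 t ht X') (norm_nonneg _) hM40
    have hfac := klmd_sum3_ite_mul_le
      (fun (p : FreqMomentum L M) (σ : Fin 2) (p' : FreqMomentum L M) =>
        matsubaraInt M p'.1 + matsubaraInt M (omega0 M) = matsubaraInt M p.1 + matsubaraInt M (omega0 M) ∧ p'.2 = p.2 + x - y)
      (fun (p : FreqMomentum L M) (σ : Fin 2) (p' : FreqMomentum L M) =>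
        ((((((Φ j t p) : ℝ) : ℂ) * (((β * (L : ℝ) ^ 2 : ℝ) : ℂ) * propCT L M β μ K p)) * ((((Wd t p') : ℝ) : ℂ) * (((β * (L : ℝ) ^ 2 : ℝ) : ℂ) * propCT L M β μ K p'))) +
          (((((Wd t p) : ℝ) : ℂ) * (((β * (L : ℝ) ^ 2 : ℝ) : ℂ) * propCT L M β μ K p)) * ((((Φ j t p') : ℝ) : ℂ) * (((β * (L : ℝ) ^ 2 : ℝ) : ℂ) * propCT L M β μ K p')))))
      (fun (p : FreqMomentum L M) (σ : Fin 2) (p' : FreqMomentum L M) =>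
        V j t ![((p, σ), 1), ((p', σ), 0), (((omega0 M, y), 0), 0), (((omega0 M, x), 0), 1)] *
          V j t ![((p, σ), 0), ((p', σ), 1), ((((omega0 M).rev, Qm - y), 1), 0), ((((omega0 M).rev, Qm - x), 1), 1)])
      (fun _ _ _ _ => hK4 _ _)
    beta_reduce at hfac
    have hfac' : (klScale klE0 n - klScale klE0 (n + 1)) * ((β * (L : ℝ) ^ 2) ^ 3)⁻¹ *
        ‖∑ p : FreqMomentum L M, ∑ σ : Fin 2, ∑ p' : FreqMomentum L M,
        if matsubaraInt M p'.1 + matsubaraInt M (omega0 M) = matsubaraInt M p.1 + matsubaraInt M (omega0 M) ∧ p'.2 = p.2 + x - y then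
          ((((((Φ j t p) : ℝ) : ℂ) * (((β * (L : ℝ) ^ 2 : ℝ) : ℂ) * propCT L M β μ K p)) * ((((Wd t p') : ℝ) : ℂ) * (((β * (L : ℝ) ^ 2 : ℝ) : ℂ) * propCT L M β μ K p'))) +
              (((((Wd t p) : ℝ) : ℂ) * (((β * (L : ℝ) ^ 2 : ℝ) : ℂ) * propCT L M β μ K p)) * ((((Φ j t p') : ℝ) : ℂ) * (((β * (L : ℝ) ^ 2 : ℝ) : ℂ) * propCT L M β μ K p')))) *
            (V j t ![((p, σ), 1), ((p', σ), 0), (((omega0 M, y), 0), 0), (((omega0 M, x), 0), 1)] *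
              V j t ![((p, σ), 0), ((p', σ), 1), ((((omega0 M).rev, Qm - y), 1), 0), ((((omega0 M).rev, Qm - x), 1), 1)])
        else 0‖ ≤
        M4 * M4 * ((klScale klE0 n - klScale klE0 (n + 1)) * ((β * (L : ℝ) ^ 2) ^ 3)⁻¹ * (∑ p : FreqMomentum L M, ∑ _σ : Fin 2, ∑ p' : FreqMomentum L M,
            if matsubaraInt M p'.1 + matsubaraInt M (omega0 M) = matsubaraInt M p.1 + matsubaraInt M (omega0 M) ∧ p'.2 = p.2 + x - y then ‖((((((Φ j t p) : ℝ) : ℂ) * (((β * (L : ℝ) ^ 2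
                    : ℝ) : ℂ) * propCT L M β μ K p)) * ((((Wd t p') : ℝ) : ℂ) * (((β * (L : ℝ) ^ 2 : ℝ) : ℂ) * propCT L M β μ K p'))) + (((((Wd t p) : ℝ) : ℂ) * (((β * (L : ℝ) ^ 2 : ℝ)
                    : ℂ) * propCT L M β μ K p)) * ((((Φ j t p') : ℝ) : ℂ) * (((β * (L : ℝ) ^ 2 : ℝ) : ℂ) * propCT L M β μ K p'))))‖ else 0)) := by
      have h := mul_le_mul_of_nonneg_left hfac hac.le
      have e : (klScale klE0 n - klScale klE0 (n + 1)) * ((β * (L : ℝ) ^ 2) ^ 3)⁻¹ * (M4 * M4 * (∑ p : FreqMomentum L M, ∑ _σ : Fin 2, ∑ p' : FreqMomentum L M,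
            if matsubaraInt M p'.1 + matsubaraInt M (omega0 M) = matsubaraInt M p.1 + matsubaraInt M (omega0 M) ∧ p'.2 = p.2 + x - y then ‖((((((Φ j t p) : ℝ) : ℂ) * (((β * (L : ℝ) ^ 2
                    : ℝ) : ℂ) * propCT L M β μ K p)) * ((((Wd t p') : ℝ) : ℂ) * (((β * (L : ℝ) ^ 2 : ℝ) : ℂ) * propCT L M β μ K p'))) + (((((Wd t p) : ℝ) : ℂ) * (((β * (L : ℝ) ^ 2 : ℝ)
                    : ℂ) * propCT L M β μ K p)) * ((((Φ j t p') : ℝ) : ℂ) * (((β * (L : ℝ) ^ 2 : ℝ) : ℂ) * propCT L M β μ K p'))))‖ else 0)) = M4 * M4 * ((klScale klE0 n - klScale klE0 (n + 1)) * ((β * (L : ℝ) ^ 2) ^ 3)⁻¹ * (∑ p : FreqMomentum L M, ∑ _σ : Fin 2, ∑ p' : FreqMomentum L M,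
            if matsubaraInt M p'.1 + matsubaraInt M (omega0 M) = matsubaraInt M p.1 + matsubaraInt M (omega0 M) ∧ p'.2 = p.2 + x - y then ‖((((((Φ j t p) : ℝ) : ℂ) * (((β * (L : ℝ) ^ 2
                    : ℝ) : ℂ) * propCT L M β μ K p)) * ((((Wd t p') : ℝ) : ℂ) * (((β * (L : ℝ) ^ 2 : ℝ) : ℂ) * propCT L M β μ K p'))) + (((((Wd t p) : ℝ) : ℂ) * (((β * (L : ℝ) ^ 2 : ℝ)
                    : ℂ) * propCT L M β μ K p)) * ((((Φ j t p') : ℝ) : ℂ) * (((β * (L : ℝ) ^ 2 : ℝ) : ℂ) * propCT L M β μ K p'))))‖ else 0)) := by ring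
      linarith only [h, e.le]
    have henv : (P.Klam * U) ^ 2 * klEngGeo11.phGain (n + 1) (klTorusNorm L (x - y)) ≤ ((P.Klam * U) ^ 2 * klEngGeo11.phGain (n + 1) (klTorusNorm L (x - y)) + thermalBar klEngGeo11 P U β (n + 1) / 4 + 2 * ((96 * (512 * L₁ / klScale klE0 (n + 1) + 32 * (2 * ‖c₀‖ + A₁) * (4 + 8 / 3 * R.Gfr 1 * U ^ 2) * ((9 * (2 * (448 / 3 * Real.exp 2) + 8) + 4 * 8) + (65 * (8 * (16 : ℝ) ^ (j - (n + 1))) + 17408 / 3 * 1)) / klScale klE0 (n + 1) ^ 2)) / L) + (ε₁ * (2048 * 15367) + A₂ * (4096 * 15381) * (ρw / π + ((L : ℝ))⁻¹))) := by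
      linarith only [hTB0, hLt0, hεF]
    by_cases h12 : n + 1 ≤ 12
    · have hb : M4 * M4 * ((klScale klE0 n - klScale klE0 (n + 1)) * ((β * (L : ℝ) ^ 2) ^ 3)⁻¹ * (∑ p : FreqMomentum L M, ∑ _σ : Fin 2, ∑ p' : FreqMomentum L M,
            if matsubaraInt M p'.1 + matsubaraInt M (omega0 M) = matsubaraInt M p.1 + matsubaraInt M (omega0 M) ∧ p'.2 = p.2 + x - y then ‖((((((Φ j t p) : ℝ) : ℂ) * (((β * (L : ℝ) ^ 2
                    : ℝ) : ℂ) * propCT L M β μ K p)) * ((((Wd t p') : ℝ) : ℂ) * (((β * (L : ℝ) ^ 2 : ℝ) : ℂ) * propCT L M β μ K p'))) + (((((Wd t p) : ℝ) : ℂ) * (((β * (L : ℝ) ^ 2 : ℝ)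
                    : ℂ) * propCT L M β μ K p)) * ((((Φ j t p') : ℝ) : ℂ) * (((β * (L : ℝ) ^ 2 : ℝ) : ℂ) * propCT L M β μ K p'))))‖ else 0)) ≤ (P.Klam * U) ^ 2 * klEngGeo11.phGain (n + 1) (klTorusNorm L (x - y)) := by
        simp only [hΦ, hWd]
        exact Wd_member_row_flat_le_phGain_klEngGeo11 β μ K hK hβ hβL n hj h12 ht x y hMM hM4K _
      linarith only [hfac', hb, henv]
    have hn1 : 1 ≤ n := by omega
    rcases legTransfer_trichotomy n (klTorusNorm L (x - y)) with hfw | ⟨hplo, hphi⟩ | htl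
    · have hq : (4 + 8 / 3 * R.Gfr 1 * U ^ 2) * klTorusNorm L (x - y) ≤ klScale klE0 (n + 1) / 8 := forward_window_small_transfer hρd0 hfw hG21
      refine (forward_member_direct_row_le_quarter_split3 B hGfr' hK hAb hA hA20 hμ n ht hβ hn' hM Φ hΦ Wd hWd V hj Qm x y hlo hhi hq c₀ (F₁ t) (F₂ t) (F₁₀ t)
        (hsplit t ht) hA1 hL1 hε1 (hY0p₁ t ht) (hY1p₁ t ht) (hY0m₁ t ht) (hY1m₁ t ht) (hflat₁ t ht) cen hρw hA2 (hF₂ t ht) (hsupp₂ t ht)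
        hβL hM40 (hM4 t ht) hM4K hZS hTH hTR).trans_eq ?_
      ring
    · have hb : M4 * M4 * ((klScale klE0 n - klScale klE0 (n + 1)) * ((β * (L : ℝ) ^ 2) ^ 3)⁻¹ * (∑ p : FreqMomentum L M, ∑ _σ : Fin 2, ∑ p' : FreqMomentum L M,
            if matsubaraInt M p'.1 + matsubaraInt M (omega0 M) = matsubaraInt M p.1 + matsubaraInt M (omega0 M) ∧ p'.2 = p.2 + x - y then ‖((((((Φ j t p) : ℝ) : ℂ) * (((β * (L : ℝ) ^ 2
                    : ℝ) : ℂ) * propCT L M β μ K p)) * ((((Wd t p') : ℝ) : ℂ) * (((β * (L : ℝ) ^ 2 : ℝ) : ℂ) * propCT L M β μ K p'))) + (((((Wd t p) : ℝ) : ℂ) * (((β * (L : ℝ) ^ 2 : ℝ)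
                    : ℂ) * propCT L M β μ K p)) * ((((Φ j t p') : ℝ) : ℂ) * (((β * (L : ℝ) ^ 2 : ℝ) : ℂ) * propCT L M β μ K p'))))‖ else 0)) ≤ (P.Klam * U) ^ 2 * klEngGeo11.phGain (n + 1) (klTorusNorm L (x - y)) := by
        simp only [hΦ, hWd]
        exact Wd_member_row_flat_le_phGain_klEngGeo11_of_plateau β μ K hK hβ hβL n hj ht x y hMM hM4K hplo hphi
      linarith only [hfac', hb, henv]
    · obtain ⟨hj'β, hGδ, hE0⟩ := tail_regime_readings (L := L) β hR hβ hn1 hn hGL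
      have hb : M4 * M4 * ((klScale klE0 n - klScale klE0 (n + 1)) * ((β * (L : ℝ) ^ 2) ^ 3)⁻¹ * (∑ p : FreqMomentum L M, ∑ _σ : Fin 2, ∑ p' : FreqMomentum L M,
            if matsubaraInt M p'.1 + matsubaraInt M (omega0 M) = matsubaraInt M p.1 + matsubaraInt M (omega0 M) ∧ p'.2 = p.2 + x - y then ‖((((((Φ j t p) : ℝ) : ℂ) * (((β * (L : ℝ) ^ 2
                    : ℝ) : ℂ) * propCT L M β μ K p)) * ((((Wd t p') : ℝ) : ℂ) * (((β * (L : ℝ) ^ 2 : ℝ) : ℂ) * propCT L M β μ K p'))) + (((((Wd t p) : ℝ) : ℂ) * (((β * (L : ℝ) ^ 2 : ℝ)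
                    : ℂ) * propCT L M β μ K p)) * ((((Φ j t p') : ℝ) : ℂ) * (((β * (L : ℝ) ^ 2 : ℝ) : ℂ) * propCT L M β μ K p'))))‖ else 0)) ≤ (P.Klam * U) ^ 2 * klEngGeo11.phGain (n + 1) (klTorusNorm L (x - y)) := by
        simp only [hΦ, hWd]
        exact Wd_member_row_le_phGain_klEngGeo11 β μ K hR hU hUu hμC hK hβ0 n hj hj'β ht hGδ hE0 hGL (tail_threshold_of_gt htl hG4) hMM hM4KG
      linarith only [hfac', hb, henv]
  -- ===== the crossed member line `RQ` under its envelope `BQ`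
  have hBQ : ∀ t ∈ Icc (0 : ℝ) 1, (klScale klE0 n - klScale klE0 (n + 1)) * ((β * (L : ℝ) ^ 2) ^ 3)⁻¹ *
      ‖∑ p : FreqMomentum L M, ∑ p' : FreqMomentum L M,
        if matsubaraInt M p'.1 + matsubaraInt M (omega0 M) + matsubaraInt M (omega0 M) + 1 = matsubaraInt M p.1 ∧ p'.2 = p.2 + Qm - x - y then
          ((((((Φ j t p) : ℝ) : ℂ) * (((β * (L : ℝ) ^ 2 : ℝ) : ℂ) * propCT L M β μ K p)) * ((((Wd t p') : ℝ) : ℂ) * (((β * (L : ℝ) ^ 2 : ℝ) : ℂ) * propCT L M β μ K p'))) +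
              (((((Wd t p) : ℝ) : ℂ) * (((β * (L : ℝ) ^ 2 : ℝ) : ℂ) * propCT L M β μ K p)) * ((((Φ j t p') : ℝ) : ℂ) * (((β * (L : ℝ) ^ 2 : ℝ) : ℂ) * propCT L M β μ K p')))) *
            (V j t ![((p, 0), 1), ((p', 1), 0), (((omega0 M, y), 0), 0), ((((omega0 M).rev, Qm - x), 1), 1)] *
              V j t ![((p, 0), 0), ((p', 1), 1), ((((omega0 M).rev, Qm - y), 1), 0), (((omega0 M, x), 0), 1)])
        else 0‖ ≤
      ((P.Klam * U) ^ 2 * klEngGeo11.phGain (n + 1) (klTorusNorm L (x + y - Qm)) + thermalBar klEngGeo11 P U β (n + 1) / 4 + 2 * ((96 * (512 * L₁ / klScale klE0 (n + 1) + 32 * (2 * ‖c₀‖ + A₁) * (4 + 8 / 3 * R.Gfr 1 * U ^ 2) * ((9 * (2 * (448 / 3 * Real.exp 2) + 8) + 4 * 8) + (65 * (8 * (16 : ℝ) ^ (j - (n + 1))) + 17408 / 3 * 1)) / klScale klE0 (n + 1) ^ 2)) / L) + (ε₁ * (2048 * 15367) + A₂ * (4096 * 15381) * (ρw / π + ((L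 : ℝ))⁻¹))) := by
    intro t ht
    have hK4 : ∀ X X', ‖V j t X * V j t X'‖ ≤ M4 * M4 := fun X X' => by
      rw [norm_mul]; exact mul_le_mul (hM4 t ht X) (hM4 t ht X') (norm_nonneg _) hM40
    have hfac := klmd_sum2_ite_mul_le
      (fun (p : FreqMomentum L M) (p' : FreqMomentum L M) =>
        matsubaraInt M p'.1 + matsubaraInt M (omega0 M) + matsubaraInt M (omega0 M) + 1 = matsubaraInt M p.1 ∧ p'.2 = p.2 + Qm - x - y)
      (fun (p : FreqMomentum L M) (p' : FreqMomentum L M) =>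
        ((((((Φ j t p) : ℝ) : ℂ) * (((β * (L : ℝ) ^ 2 : ℝ) : ℂ) * propCT L M β μ K p)) * ((((Wd t p') : ℝ) : ℂ) * (((β * (L : ℝ) ^ 2 : ℝ) : ℂ) * propCT L M β μ K p'))) +
          (((((Wd t p) : ℝ) : ℂ) * (((β * (L : ℝ) ^ 2 : ℝ) : ℂ) * propCT L M β μ K p)) * ((((Φ j t p') : ℝ) : ℂ) * (((β * (L : ℝ) ^ 2 : ℝ) : ℂ) * propCT L M β μ K p')))))
      (fun (p : FreqMomentum L M) (p' : FreqMomentum L M) =>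
        V j t ![((p, 0), 1), ((p', 1), 0), (((omega0 M, y), 0), 0), ((((omega0 M).rev, Qm - x), 1), 1)] *
          V j t ![((p, 0), 0), ((p', 1), 1), ((((omega0 M).rev, Qm - y), 1), 0), (((omega0 M, x), 0), 1)])
      (fun _ _ _ => hK4 _ _)
    beta_reduce at hfac
    have hfac' : (klScale klE0 n - klScale klE0 (n + 1)) * ((β * (L : ℝ) ^ 2) ^ 3)⁻¹ *
        ‖∑ p : FreqMomentum L M, ∑ p' : FreqMomentum L M,
        if matsubaraInt M p'.1 + matsubaraInt M (omega0 M) + matsubaraInt M (omega0 M) + 1 = matsubaraInt M p.1 ∧ p'.2 = p.2 + Qm - x - y then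
          ((((((Φ j t p) : ℝ) : ℂ) * (((β * (L : ℝ) ^ 2 : ℝ) : ℂ) * propCT L M β μ K p)) * ((((Wd t p') : ℝ) : ℂ) * (((β * (L : ℝ) ^ 2 : ℝ) : ℂ) * propCT L M β μ K p'))) +
              (((((Wd t p) : ℝ) : ℂ) * (((β * (L : ℝ) ^ 2 : ℝ) : ℂ) * propCT L M β μ K p)) * ((((Φ j t p') : ℝ) : ℂ) * (((β * (L : ℝ) ^ 2 : ℝ) : ℂ) * propCT L M β μ K p')))) *
            (V j t ![((p, 0), 1), ((p', 1), 0), (((omega0 M, y), 0), 0), ((((omega0 M).rev, Qm - x), 1), 1)] *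
              V j t ![((p, 0), 0), ((p', 1), 1), ((((omega0 M).rev, Qm - y), 1), 0), (((omega0 M, x), 0), 1)])
        else 0‖ ≤
        M4 * M4 * ((klScale klE0 n - klScale klE0 (n + 1)) * ((β * (L : ℝ) ^ 2) ^ 3)⁻¹ * (∑ p : FreqMomentum L M, ∑ p' : FreqMomentum L M,
            if matsubaraInt M p'.1 + matsubaraInt M (omega0 M) + matsubaraInt M (omega0 M) + 1 = matsubaraInt M p.1 ∧ p'.2 = p.2 + Qm - x - y then ‖((((((Φ j t p) : ℝ) : ℂ) * (((β * (L
                    : ℝ) ^ 2 : ℝ) : ℂ) * propCT L M β μ K p)) * ((((Wd t p') : ℝ) : ℂ) * (((β * (L : ℝ) ^ 2 : ℝ) : ℂ) * propCT L M β μ K p'))) + (((((Wd t p) : ℝ) : ℂ) * (((β * (L : ℝ)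
                    ^ 2 : ℝ) : ℂ) * propCT L M β μ K p)) * ((((Φ j t p') : ℝ) : ℂ) * (((β * (L : ℝ) ^ 2 : ℝ) : ℂ) * propCT L M β μ K p'))))‖ else 0)) := by
      have h := mul_le_mul_of_nonneg_left hfac hac.le
      have e : (klScale klE0 n - klScale klE0 (n + 1)) * ((β * (L : ℝ) ^ 2) ^ 3)⁻¹ * (M4 * M4 * (∑ p : FreqMomentum L M, ∑ p' : FreqMomentum L M,
            if matsubaraInt M p'.1 + matsubaraInt M (omega0 M) + matsubaraInt M (omega0 M) + 1 = matsubaraInt M p.1 ∧ p'.2 = p.2 + Qm - x - y then ‖((((((Φ j t p) : ℝ) : ℂ) * (((β * (L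
                    : ℝ) ^ 2 : ℝ) : ℂ) * propCT L M β μ K p)) * ((((Wd t p') : ℝ) : ℂ) * (((β * (L : ℝ) ^ 2 : ℝ) : ℂ) * propCT L M β μ K p'))) + (((((Wd t p) : ℝ) : ℂ) * (((β * (L : ℝ)
                    ^ 2 : ℝ) : ℂ) * propCT L M β μ K p)) * ((((Φ j t p') : ℝ) : ℂ) * (((β * (L : ℝ) ^ 2 : ℝ) : ℂ) * propCT L M β μ K p'))))‖ else 0)) = M4 * M4 * ((klScale klE0 n - klScale klE0 (n + 1)) * ((β * (L : ℝ) ^ 2) ^ 3)⁻¹ * (∑ p : FreqMomentum L M, ∑ p' : FreqMomentum L M,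
            if matsubaraInt M p'.1 + matsubaraInt M (omega0 M) + matsubaraInt M (omega0 M) + 1 = matsubaraInt M p.1 ∧ p'.2 = p.2 + Qm - x - y then ‖((((((Φ j t p) : ℝ) : ℂ) * (((β * (L
                    : ℝ) ^ 2 : ℝ) : ℂ) * propCT L M β μ K p)) * ((((Wd t p') : ℝ) : ℂ) * (((β * (L : ℝ) ^ 2 : ℝ) : ℂ) * propCT L M β μ K p'))) + (((((Wd t p) : ℝ) : ℂ) * (((β * (L : ℝ)
                    ^ 2 : ℝ) : ℂ) * propCT L M β μ K p)) * ((((Φ j t p') : ℝ) : ℂ) * (((β * (L : ℝ) ^ 2 : ℝ) : ℂ) * propCT L M β μ K p'))))‖ else 0)) := by ring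
      linarith only [h, e.le]
    have henv : (P.Klam * U) ^ 2 * klEngGeo11.phGain (n + 1) (klTorusNorm L (x + y - Qm)) ≤ ((P.Klam * U) ^ 2 * klEngGeo11.phGain (n + 1) (klTorusNorm L (x + y - Qm)) + thermalBar klEngGeo11 P U β (n + 1) / 4 + 2 * ((96 * (512 * L₁ / klScale klE0 (n + 1) + 32 * (2 * ‖c₀‖ + A₁) * (4 + 8 / 3 * R.Gfr 1 * U ^ 2) * ((9 * (2 * (448 / 3 * Real.exp 2) + 8) + 4 * 8) + (65 * (8 * (16 : ℝ) ^ (j - (n + 1))) + 17408 / 3 * 1)) / klScale klE0 (n + 1) ^ 2)) / L) + (ε₁ * (2048 * 15367) + A₂ * (4096 * 15381) * (ρw / π + ((L : ℝ))⁻¹))) := by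
      linarith only [hTB0, hLt0, hεF]
    have henvT : thermalBar klEngGeo11 P U β (n + 1) / 4 ≤ ((P.Klam * U) ^ 2 * klEngGeo11.phGain (n + 1) (klTorusNorm L (x + y - Qm)) + thermalBar klEngGeo11 P U β (n + 1) / 4 + 2 * ((96 * (512 * L₁ / klScale klE0 (n + 1) + 32 * (2 * ‖c₀‖ + A₁) * (4 + 8 / 3 * R.Gfr 1 * U ^ 2) * ((9 * (2 * (448 / 3 * Real.exp 2) + 8) + 4 * 8) + (65 * (8 * (16 : ℝ) ^ (j - (n + 1))) + 17408 / 3 * 1)) / klScale klE0 (n + 1) ^ 2)) / L) + (ε₁ * (2048 * 15367) + A₂ * (4096 * 15381) * (ρw / π + ((L : ℝ))⁻¹))) := by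
      linarith only [mul_nonneg hKl (hph0 (n + 1) (klTorusNorm L (x + y - Qm))), hLt0, hεF]
    by_cases h12 : n + 1 ≤ 12
    · have hb : M4 * M4 * ((klScale klE0 n - klScale klE0 (n + 1)) * ((β * (L : ℝ) ^ 2) ^ 3)⁻¹ * (∑ p : FreqMomentum L M, ∑ p' : FreqMomentum L M,
            if matsubaraInt M p'.1 + matsubaraInt M (omega0 M) + matsubaraInt M (omega0 M) + 1 = matsubaraInt M p.1 ∧ p'.2 = p.2 + Qm - x - y then ‖((((((Φ j t p) : ℝ) : ℂ) * (((β * (L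
                    : ℝ) ^ 2 : ℝ) : ℂ) * propCT L M β μ K p)) * ((((Wd t p') : ℝ) : ℂ) * (((β * (L : ℝ) ^ 2 : ℝ) : ℂ) * propCT L M β μ K p'))) + (((((Wd t p) : ℝ) : ℂ) * (((β * (L : ℝ)
                    ^ 2 : ℝ) : ℂ) * propCT L M β μ K p)) * ((((Φ j t p') : ℝ) : ℂ) * (((β * (L : ℝ) ^ 2 : ℝ) : ℂ) * propCT L M β μ K p'))))‖ else 0)) ≤ (P.Klam * U) ^ 2 * klEngGeo11.phGain (n + 1) (klTorusNorm L (x + y - Qm)) := by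
        simp only [hΦ, hWd]
        exact Wx_member_row_flat_le_phGain_klEngGeo11 β μ K hK hβ hβL n hj h12 ht Qm x y hMM hM4K _
      linarith only [hfac', hb, henv]
    have hn1 : 1 ≤ n := by omega
    rcases legTransfer_trichotomy n (klTorusNorm L (x + y - Qm)) with hfw | ⟨hplo, hphi⟩ | htl
    · by_cases hband : nScales β ≤ n + 2
      · have hb : M4 * M4 * ((klScale klE0 n - klScale klE0 (n + 1)) * ((β * (L : ℝ) ^ 2) ^ 3)⁻¹ * (∑ p : FreqMomentum L M, ∑ p' : FreqMomentum L M,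
            if matsubaraInt M p'.1 + matsubaraInt M (omega0 M) + matsubaraInt M (omega0 M) + 1 = matsubaraInt M p.1 ∧ p'.2 = p.2 + Qm - x - y then ‖((((((Φ j t p) : ℝ) : ℂ) * (((β * (L
                    : ℝ) ^ 2 : ℝ) : ℂ) * propCT L M β μ K p)) * ((((Wd t p') : ℝ) : ℂ) * (((β * (L : ℝ) ^ 2 : ℝ) : ℂ) * propCT L M β μ K p'))) + (((((Wd t p) : ℝ) : ℂ) * (((β * (L : ℝ)
                    ^ 2 : ℝ) : ℂ) * propCT L M β μ K p)) * ((((Φ j t p') : ℝ) : ℂ) * (((β * (L : ℝ) ^ 2 : ℝ) : ℂ) * propCT L M β μ K p'))))‖ else 0)) ≤ thermalBar klEngGeo11 P U β (n + 1) / 4 := by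
          simp only [hΦ, hWd]
          exact Wx_member_row_flat_le_thermalBar_of_band β μ K hK hβ hβL n hj hband ht Qm x y hMM hM4K
        linarith only [hfac', hb, henvT]
      · have hβn : 16 * π / β ≤ klScale klE0 (n + 1) := sixteen_pi_div_le_klScale_succ_of_le_nScales hβ (by omega)
        have hq : (4 + 8 / 3 * R.Gfr 1 * U ^ 2) * klTorusNorm L (Qm - x - y) ≤ klScale klE0 (n + 1) / 8 := by
          rw [hρxe]; exact forward_window_small_transfer hρx0 hfw hG21
        refine (forward_member_crossed_row_le_quarter_split3 B hGfr' hK hAb hA hA20 hμ n ht hβ hn' hβn hM Φ hΦ Wd hWd V hj Qm x y hlo hhi hq c₀ (Fx₁ t) (Fx₂ t) (Fx₁₀ t)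
          (hsplitX t ht) hA1 hL1 hε1 (hY0B₁ t ht) (hY1B₁ t ht) (hY0A₁ t ht) (hY1A₁ t ht) (hflatX₁ t ht) cenx hρw hA2 (hFx₂ t ht) (hsuppx₂ t ht)
          hβL hM40 (hM4 t ht) hM4K hZS hTHR hTR).trans_eq ?_
        ring
    · have hb : M4 * M4 * ((klScale klE0 n - klScale klE0 (n + 1)) * ((β * (L : ℝ) ^ 2) ^ 3)⁻¹ * (∑ p : FreqMomentum L M, ∑ p' : FreqMomentum L M,
            if matsubaraInt M p'.1 + matsubaraInt M (omega0 M) + matsubaraInt M (omega0 M) + 1 = matsubaraInt M p.1 ∧ p'.2 = p.2 + Qm - x - y then ‖((((((Φ j t p) : ℝ) : ℂ) * (((β * (L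
                    : ℝ) ^ 2 : ℝ) : ℂ) * propCT L M β μ K p)) * ((((Wd t p') : ℝ) : ℂ) * (((β * (L : ℝ) ^ 2 : ℝ) : ℂ) * propCT L M β μ K p'))) + (((((Wd t p) : ℝ) : ℂ) * (((β * (L : ℝ)
                    ^ 2 : ℝ) : ℂ) * propCT L M β μ K p)) * ((((Φ j t p') : ℝ) : ℂ) * (((β * (L : ℝ) ^ 2 : ℝ) : ℂ) * propCT L M β μ K p'))))‖ else 0)) ≤ (P.Klam * U) ^ 2 * klEngGeo11.phGain (n + 1) (klTorusNorm L (x + y - Qm)) := by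
        simp only [hΦ, hWd]
        exact Wx_member_row_flat_le_phGain_klEngGeo11_of_plateau β μ K hK hβ hβL n hj ht Qm x y hMM hM4K hplo hphi
      linarith only [hfac', hb, henv]
    · obtain ⟨hj'β, hGδ, hE0⟩ := tail_regime_readings (L := L) β hR hβ hn1 hn hGL
      have hb : M4 * M4 * ((klScale klE0 n - klScale klE0 (n + 1)) * ((β * (L : ℝ) ^ 2) ^ 3)⁻¹ * (∑ p : FreqMomentum L M, ∑ p' : FreqMomentum L M,
            if matsubaraInt M p'.1 + matsubaraInt M (omega0 M) + matsubaraInt M (omega0 M) + 1 = matsubaraInt M p.1 ∧ p'.2 = p.2 + Qm - x - y then ‖((((((Φ j t p) : ℝ) : ℂ) * (((β * (L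
                    : ℝ) ^ 2 : ℝ) : ℂ) * propCT L M β μ K p)) * ((((Wd t p') : ℝ) : ℂ) * (((β * (L : ℝ) ^ 2 : ℝ) : ℂ) * propCT L M β μ K p'))) + (((((Wd t p) : ℝ) : ℂ) * (((β * (L : ℝ)
                    ^ 2 : ℝ) : ℂ) * propCT L M β μ K p)) * ((((Φ j t p') : ℝ) : ℂ) * (((β * (L : ℝ) ^ 2 : ℝ) : ℂ) * propCT L M β μ K p'))))‖ else 0)) ≤ (P.Klam * U) ^ 2 * klEngGeo11.phGain (n + 1) (klTorusNorm L (x + y - Qm)) := by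
        simp only [hΦ, hWd]
        exact Wx_member_row_le_phGain_klEngGeo11 β μ K hR hU hUu hμC hK hβ0 n hj hj'β ht hGδ hE0 hGL (tail_threshold_of_gt htl hG4) hMM hM4KG
      linarith only [hfac', hb, henv]
  -- ===== the rows-family door per `t`, with `RP := BP/(ac)`, `RQ := BQ/(ac)`
  have hpt : ∀ t ∈ Icc (0 : ℝ) 1, ‖(fun s => A' j Qm s + A j Qm s * diagonal (b' j Qm s) * A j Qm s) t x y‖ ≤
      (klScale klE0 n - klScale klE0 (n + 1)) * (2⁻¹ * RH) + ((P.Klam * U) ^ 2 * klEngGeo11.phGain (n + 1) (klTorusNorm L (x - y)) + thermalBar klEngGeo11 P U β (n + 1) / 4 + 2 * ((96 * (512 * L₁ / klScale klE0 (n + 1) + 32 * (2 * ‖c₀‖ + A₁) * (4 + 8 / 3 * R.Gfr 1 * U ^ 2) * ((9 * (2 * (448 / 3 * Real.exp 2) + 8) + 4 * 8) + (65 * (8 * (16 : ℝ) ^ (j - (n + 1))) + 17408 / 3 * 1)) / klScale klE0 (n + 1) ^ 2)) / L) + (ε₁ * (2048 * 15367) + A₂ * (4096 * 15381) * (ρw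 / π + ((L : ℝ))⁻¹))) + ((P.Klam * U) ^ 2 * klEngGeo11.phGain (n + 1) (klTorusNorm L (x + y - Qm)) + thermalBar klEngGeo11 P U β (n + 1) / 4 + 2 * ((96 * (512 * L₁ / klScale klE0 (n + 1) + 32 * (2 * ‖c₀‖ + A₁) * (4 + 8 / 3 * R.Gfr 1 * U ^ 2) * ((9 * (2 * (448 / 3 * Real.exp 2) + 8) + 4 * 8) + (65 * (8 * (16 : ℝ) ^ (j - (n + 1))) + 17408 / 3 * 1)) / klScale klE0 (n + 1) ^ 2)) / L) + (ε₁ * (2048 * 15367) + A₂ * (4096 * 15381) * (ρw / π + ((L : ℝ))⁻¹))) + (klScale klE0 n - klScale klE0 (n + 1)) * (((β * (L : ℝ) ^ 2) ^ 3)⁻¹ * (2 * RS)) + RL := by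
    intro t ht
    have hP := (le_div_iff₀' hac).mpr (hBP t ht)
    have hQ' := (le_div_iff₀' hac).mpr (hBQ t ht)
    have hrows := klmd_defect_le_rows_family L M β U μ K hβ0 n A A' b' hAdef hA'def hb'def V hV V6 hV6 Sg hSg Hd hHd Φ hΦ Wd hWd Br hBr j Qm ht x y
      (hH t ht) hP hQ' (hRS t ht) (hL t ht)
    have e : (klScale klE0 n - klScale klE0 (n + 1)) * (2⁻¹ * RH + ((β * (L : ℝ) ^ 2) ^ 3)⁻¹ *
        (((P.Klam * U) ^ 2 * klEngGeo11.phGain (n + 1) (klTorusNorm L (x - y)) + thermalBar klEngGeo11 P U β (n + 1) / 4 + 2 * ((96 * (512 * L₁ / klScale klE0 (n + 1) + 32 * (2 * ‖c₀‖ + A₁) * (4 + 8 / 3 * R.Gfr 1 * U ^ 2) * ((9 * (2 * (448 / 3 * Real.exp 2) + 8) + 4 * 8) + (65 * (8 * (16 : ℝ) ^ (j - (n + 1))) + 17408 / 3 * 1)) / klScale klE0 (n + 1) ^ 2)) / L) + (ε₁ * (2048 * 15367) + A₂ * (4096 * 15381) * (ρw / π + ((L : ℝ))⁻¹))) / ((klScale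 klE0 n - klScale klE0 (n + 1)) * ((β * (L : ℝ) ^ 2) ^ 3)⁻¹) + ((P.Klam * U) ^ 2 * klEngGeo11.phGain (n + 1) (klTorusNorm L (x + y - Qm)) + thermalBar klEngGeo11 P U β (n + 1) / 4 + 2 * ((96 * (512 * L₁ / klScale klE0 (n + 1) + 32 * (2 * ‖c₀‖ + A₁) * (4 + 8 / 3 * R.Gfr 1 * U ^ 2) * ((9 * (2 * (448 / 3 * Real.exp 2) + 8) + 4 * 8) + (65 * (8 * (16 : ℝ) ^ (j - (n + 1))) + 17408 / 3 * 1)) / klScale klE0 (n + 1) ^ 2)) / L) + (ε₁ * (2048 * 15367) + A₂ * (4096 * 15381) * (ρw / π + ((L : ℝ))⁻¹))) / ((klScale klE0 n - klScale klE0 (n + 1)) * ((β * (L : ℝ) ^ 2) ^ 3)⁻¹) + 2 * RS)) + RL =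
        (klScale klE0 n - klScale klE0 (n + 1)) * (2⁻¹ * RH) + ((P.Klam * U) ^ 2 * klEngGeo11.phGain (n + 1) (klTorusNorm L (x - y)) + thermalBar klEngGeo11 P U β (n + 1) / 4 + 2 * ((96 * (512 * L₁ / klScale klE0 (n + 1) + 32 * (2 * ‖c₀‖ + A₁) * (4 + 8 / 3 * R.Gfr 1 * U ^ 2) * ((9 * (2 * (448 / 3 * Real.exp 2) + 8) + 4 * 8) + (65 * (8 * (16 : ℝ) ^ (j - (n + 1))) + 17408 / 3 * 1)) / klScale klE0 (n + 1) ^ 2)) / L) + (ε₁ * (2048 * 15367) + A₂ * (4096 * 15381) * (ρw / π + ((L : ℝ))⁻¹))) + ((P.Klam * U) ^ 2 * klEngGeo11.phGain (n + 1) (klTorusNorm L (x + y - Qm)) + thermalBar klEngGeo11 P U β (n + 1) / 4 + 2 * ((96 * (512 * L₁ / klScale klE0 (n + 1) + 32 * (2 * ‖c₀‖ + A₁) * (4 + 8 / 3 * R.Gfr 1 * U ^ 2) * ((9 * (2 * (448 / 3 * Real.exp 2) + 8) + 4 * 8) + (65 * (8 * (16 : ℝ) ^ (j - (n + 1))) +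 17408 / 3 * 1)) / klScale klE0 (n + 1) ^ 2)) / L) + (ε₁ * (2048 * 15367) + A₂ * (4096 * 15381) * (ρw / π + ((L : ℝ))⁻¹))) + (klScale klE0 n - klScale klE0 (n + 1)) * (((β * (L : ℝ) ^ 2) ^ 3)⁻¹ * (2 * RS)) + RL := by
      field_simp
      ring
    rw [e] at hrows
    exact hrows
  have hint := integral_le_of_forall_le_Icc (fun t _ => norm_nonneg _) hpt
  have hinc := klmf_memberArray_increment_le_source_add_ppGain L M β U μ K hR hU hUu hμC hK hβ hβL hn hj hGL hQ hZ (A j Qm) (A' j Qm)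
    (by subst hAdef; rfl) (by subst hA'def; rfl) (b' j Qm) (by subst hb'def; rfl)
    (fun s => A' j Qm s + A j Qm s * diagonal (b' j Qm s) * A j Qm s) (fun s _ => rfl) hm0 hm hAm x y
  unfold gainBar
  have eR : (klScale klE0 n - klScale klE0 (n + 1)) * (2⁻¹ * RH) + (klScale klE0 n - klScale klE0 (n + 1)) * (((β * (L : ℝ) ^ 2) ^ 3)⁻¹ * (2 * RS)) = (klScale klE0 n - klScale klE0 (n + 1)) * (2⁻¹ * RH + ((β * (L : ℝ) ^ 2) ^ 3)⁻¹ * (2 * RS)) := by ring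
  linarith

end Model

end Summit.HubbardSuperconductivity.HubbardSuperconductivity.Theorems.KLRegimeSplit

end
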